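import Literature.Topology.PlanarFoliations.WalkBuild
import Literature.Topology.PlaneTopology.JordanSweepParity
import HarnessLib

/-!
# The polygon of a simple cycle of separatrices is a Jordan loop

Topic: Topology / PlanarFoliations, sequel to `WalkBuild.lean` (junctions `cycJ` and links
`cycℓ` of a cycle of separatrices `sx i` between the punctures `vtx i`, `i ∈ Fin m`). The
**polygon** of the cycle is the closed curve: from `vtx i` out along the prong of the outgoing
separatrix to the prong point (`outArc i`), along the leaf arc `ι ∘ cycℓ i` (`linkArc i`), back in
along the prong at `vtx (i + 1)` (`inArc i`) — the *piece* `piece i` — for `i = 0, …, m - 1`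
(`polyTrace`). For a **simple** cycle (distinct punctures, distinct leaves) **the polygon is a
Jordan loop** (`isJordanLoop_polyLoop`): within a piece the three arcs are separated by the leaf
order of `sx (i + 1)` (prong arcs are tails, `ProngTailsOrder.lean`), different pieces run on
different leaves, and the punctures are off the domain.

## References

* C. Camacho, A. Lins Neto, *Geometric Theory of Foliations*, Birkhäuser (1985), Ch. VII §2
  [CamachoLinsNeto1985].
-/

noncomputable section

open Set Filter Function Metric unitInterval
open _root_.Topology
open Literature.Topology.FourManifolds Literature.Topology.FourManifolds.Foliation Literature.Topology.PlaneTopology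

namespace Literature.Topology.PlanarFoliations

/-! ## Injectivity of level-free concatenations -/

section TransFun

variable {Y : Type*} {f f' : I → Y}

/-- The first half parameter is injective on `[0, 1/2]`. [folklore] -/
theorem fstHalf_injOn {θ θ' : I} (h : (θ : ℝ) ≤ 1 / 2) (h' : (θ' : ℝ) ≤ 1 / 2) (he : fstHalf θ = fstHalf θ') : θ = θ' := by
  apply Subtype.ext
  have := congrArg (fun a : I ↦ (a : ℝ)) he
  simp only [coe_fstHalf h, coe_fstHalf h'] at this
  linarith

/-- The second half parameter is injective on `[1/2, 1]`. [folklore] -/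
theorem sndHalf_injOn {θ θ' : I} (h : 1 / 2 ≤ (θ : ℝ)) (h' : 1 / 2 ≤ (θ' : ℝ)) (he : sndHalf θ = sndHalf θ') : θ = θ' := by
  apply Subtype.ext
  have := congrArg (fun a : I ↦ (a : ℝ)) he
  simp only [coe_sndHalf h, coe_sndHalf h'] at this
  linarith

/-- **Equal values of a concatenation of injective pieces meeting only at their ends** come from
equal parameters, or from the two ends when the pieces also close up. [folklore] -/
theorem transFun_eq_transFun_imp (hf : Injective f) (hf' : Injective f')
    (hmeet : ∀ θ θ', f θ = f' θ' → (θ = 1 ∧ θ' = 0) ∨ (θ = 0 ∧ θ' = 1)) {θ θ' : I}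
    (he : transFun f f' θ = transFun f f' θ') : θ = θ' ∨ (θ = 0 ∧ θ' = 1) ∨ (θ = 1 ∧ θ' = 0) := by
  unfold transFun at he
  have key : ∀ {a b : I}, (a : ℝ) ≤ 1 / 2 → ¬ (b : ℝ) ≤ 1 / 2 → f (fstHalf a) = f' (sndHalf b) → a = 0 ∧ b = 1 := by
    intro a b ha hb hab
    rcases hmeet _ _ hab with ⟨h1, h2⟩ | ⟨h1, h2⟩
    · exfalso
      have := congrArg (fun c : I ↦ (c : ℝ)) h2
      simp only [coe_sndHalf (not_le.1 hb).le] at this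
      have hb' : (b : ℝ) = 1 / 2 := by norm_num at this; linarith
      exact hb hb'.le
    · have h1' := congrArg (fun c : I ↦ (c : ℝ)) h1
      have h2' := congrArg (fun c : I ↦ (c : ℝ)) h2
      simp only [coe_fstHalf ha] at h1'
      simp only [coe_sndHalf (not_le.1 hb).le] at h2'
      norm_num at h1' h2'
      exact ⟨Subtype.ext (by simpa using h1'), Subtype.ext (show (b : ℝ) = 1 by linarith)⟩
  split_ifs at he with h₁ h₂ h₂
  · exact Or.inl (fstHalf_injOn h₁ h₂ (hf he))
  · exact Or.inr (Or.inl (key h₁ h₂ he))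
  · obtain ⟨h0, h1⟩ := key h₂ h₁ he.symm
    exact Or.inr (Or.inr ⟨h1, h0⟩)
  · exact Or.inl (sndHalf_injOn (not_le.1 h₁).le (not_le.1 h₂).le (hf' he))

/-- **A concatenation of injective pieces meeting only at the junction is injective.**
[folklore] -/
theorem injective_transFun (hf : Injective f) (hf' : Injective f') (hmeet : ∀ θ θ', f θ = f' θ' → θ = 1 ∧ θ' = 0) :
    Injective (transFun f f') := by
  intro θ θ' he
  rcases transFun_eq_transFun_imp hf hf' (fun a b h ↦ Or.inl (hmeet a b h)) he with h | ⟨h0, h1⟩ | ⟨h1, h0⟩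
  · exact h
  · -- `f 0 = f' 1` would be a meeting off the junction
    exfalso
    subst h0; subst h1
    have : transFun f f' 0 = transFun f f' 1 := he
    rw [transFun_zero, transFun_one] at this
    exact absurd (hmeet 0 1 this).1 (by norm_num)
  · exfalso
    subst h0; subst h1
    have : transFun f f' 1 = transFun f f' 0 := he
    rw [transFun_zero, transFun_one] at this
    exact absurd (hmeet 0 1 this.symm).1 (by norm_num)

/-- The range of a concatenation. [folklore] -/
theorem range_transFun_subset : range (transFun f f') ⊆ range f ∪ range f' := by
  rintro _ ⟨θ, rfl⟩
  unfold transFun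
  split_ifs
  exacts [Or.inl ⟨_, rfl⟩, Or.inr ⟨_, rfl⟩]

/-- Values of a concatenation in the first half. [folklore] -/
theorem transFun_apply_of_le {θ : I} (h : (θ : ℝ) ≤ 1 / 2) : transFun f f' θ = f (fstHalf θ) := by
  unfold transFun; rw [if_pos h]

/-- Values of a concatenation in the second half. [folklore] -/
theorem transFun_apply_of_lt {θ : I} (h : 1 / 2 < (θ : ℝ)) : transFun f f' θ = f' (sndHalf θ) := by
  unfold transFun; rw [if_neg (not_le.2 h)]

/-- The parameter of the first half with a given first-half parameter. [folklore] -/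
def halfPt (θ : I) : I := ⟨(θ : ℝ) / 2, by constructor <;> linarith [θ.2.1, θ.2.2]⟩

/-- The parameter of the second half with a given second-half parameter. [folklore] -/
def halfPt' (θ : I) : I := ⟨((θ : ℝ) + 1) / 2, by constructor <;> linarith [θ.2.1, θ.2.2]⟩

/-- The first-half parameter of `halfPt θ` is `θ`. [folklore] -/
theorem fstHalf_halfPt (θ : I) : fstHalf (halfPt θ) = θ := by
  apply Subtype.ext
  rw [coe_fstHalf (show ((halfPt θ : I) : ℝ) ≤ 1 / 2 by show (θ : ℝ) / 2 ≤ 1 / 2; linarith [θ.2.2])]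
  show 2 * ((θ : ℝ) / 2) = θ
  ring

/-- The second-half parameter of `halfPt' θ` is `θ`. [folklore] -/
theorem sndHalf_halfPt' (θ : I) : sndHalf (halfPt' θ) = θ := by
  apply Subtype.ext
  rw [coe_sndHalf (show 1 / 2 ≤ ((halfPt' θ : I) : ℝ) by show 1 / 2 ≤ ((θ : ℝ) + 1) / 2; linarith [θ.2.1])]
  show 2 * (((θ : ℝ) + 1) / 2) - 1 = θ
  ring

/-- The concatenation at `halfPt θ` is the first piece at `θ`. [folklore] -/
theorem transFun_halfPt (θ : I) : transFun f f' (halfPt θ) = f θ := by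
  rw [transFun_apply_of_le (show ((halfPt θ : I) : ℝ) ≤ 1 / 2 by show (θ : ℝ) / 2 ≤ 1 / 2; linarith [θ.2.2]), fstHalf_halfPt]

/-- The concatenation at `halfPt' θ`, `θ > 0`, is the second piece at `θ`. [folklore] -/
theorem transFun_halfPt' {θ : I} (h : 0 < (θ : ℝ)) : transFun f f' (halfPt' θ) = f' θ := by
  rw [transFun_apply_of_lt (show 1 / 2 < ((halfPt' θ : I) : ℝ) by show 1 / 2 < ((θ : ℝ) + 1) / 2; linarith), sndHalf_halfPt']

/-- **The range of a concatenation of pieces agreeing at the junction.** [folklore] -/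
theorem range_transFun_eq (h : f 1 = f' 0) : range (transFun f f') = range f ∪ range f' := by
  refine Subset.antisymm range_transFun_subset (union_subset ?_ ?_)
  · rintro _ ⟨θ, rfl⟩; exact ⟨halfPt θ, transFun_halfPt θ⟩
  · rintro _ ⟨θ, rfl⟩
    rcases eq_or_lt_of_le θ.2.1 with h0 | h0
    · have : θ = 0 := Subtype.ext h0.symm
      rw [this, ← h]
      exact ⟨halfPt 1, transFun_halfPt 1⟩
    · exact ⟨halfPt' θ, transFun_halfPt' h0⟩

end TransFun

/-! ## The pieces of the polygon -/

variable {X : Type*} [TopologicalSpace X] [T2Space X] [SecondCountableTopology X] [Nonempty X] {F : Foliation ℝ X} {ι : X → ℂ}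
variable {B : Type*} [NormedAddCommGroup B] {M : Type*} [TopologicalSpace M] {T : Foliation B M} {g : ℂ → M}
variable {hbi : IsBiOriented F}

namespace ProngStar

variable {v : ℂ} {n : ℕ} (P : ProngStar F ι v n)

omit [T2Space X] [SecondCountableTopology X] [Nonempty X] in
/-- The inverse coordinates are injective on the half square. [folklore] -/
theorem pt_injOn (j : ZMod n) : InjOn (P.pt j) P.rect := fun p hp q hq h ↦ by
  rw [← P.chart_pt hp (j := j), ← P.chart_pt hq (j := j), h]

end ProngStar

namespace StarData

variable (D : StarData F ι T g) (hι : IsOpenEmbedding ι)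
variable {m : ℕ} [NeZero m] {C : Set ℂ} (hC : IsCompact C) {vtx : Fin m → ℂ} {sx : Fin m → X}
  [hnc : ∀ i, NoncompactSpace (F.Leaf (sx i))]
  (hv : ∀ i, vtx i ∈ D.P) (hmem : ∀ i, ∀ q : F.Leaf (sx i), ι (Leaf.pt q) ∈ C)
  (hω : ∀ i, omegaSet hbi ι (sx i) = {vtx i}) (hα : ∀ i, alphaSet hbi ι (sx (i + 1)) = {vtx i})

/-- **The outgoing prong arc** of the junction `i`: from `vtx i` to the outgoing prong point.
[folklore] -/
def outArc (i : Fin m) (u : I) : ℂ :=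
  (D.star (vtx i) (D.nprong_vtx_ne_zero hC hv hmem hω i (hbi := hbi))).pt (D.jc hι hC hv hmem hω hα i).Eb.j
    ((u : ℝ) * (D.jc hι hC hv hmem hω hα i).β, 0)

/-- **The incoming prong arc** of the junction `i + 1`: from the incoming prong point to
`vtx (i + 1)`. [folklore] -/
def inArc (i : Fin m) (u : I) : ℂ :=
  (D.star (vtx (i + 1)) (D.nprong_vtx_ne_zero hC hv hmem hω (i + 1) (hbi := hbi))).pt (D.jc hι hC hv hmem hω hα (i + 1)).Ef.j
    ((1 - (u : ℝ)) * (D.jc hι hC hv hmem hω hα (i + 1)).β, 0)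

/-- **The link arc** of the piece `i`, in the plane. [folklore] -/
def linkArc (i : Fin m) (u : I) : ℂ := ι (D.cycℓ hι hC hv hmem hω hα i u)

/-- **The piece `i` of the polygon**: out along the prong, along the leaf, in along the next
prong. [folklore] -/
def piece (i : Fin m) : I → ℂ :=
  transFun (transFun (D.outArc hι hC hv hmem hω hα i) (D.linkArc hι hC hv hmem hω hα i)) (D.inArc hι hC hv hmem hω hα i)

section Piece

variable (i : Fin m)

/-- The parameters of the outgoing arc are in the half square. [folklore] -/
theorem outArc_mem_rect (u : I) :
    (((u : ℝ) * (D.jc hι hC hv hmem hω hα i).β, (0 : ℝ)) : ℝ × ℝ) ∈ (D.star (vtx i) (D.nprong_vtx_ne_zero hC hv hmem hω i (hbi := hbi))).rect := by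
  set E := D.jc hι hC hv hmem hω hα i
  have hβ : 0 < E.β ∧ E.β ≤ (D.star (vtx i) _).ρ := ⟨E.hβout.1, E.hβout.2.trans E.Eb.hβ₀.2⟩
  refine (ProngStar.mem_rect_iff _).2 ⟨⟨mul_nonneg u.2.1 hβ.1.le, ?_⟩, by simp [(D.star (vtx i) _).ρ_pos.le]⟩
  calc (u : ℝ) * E.β ≤ 1 * E.β := mul_le_mul_of_nonneg_right u.2.2 hβ.1.le
    _ = E.β := one_mul _
    _ ≤ _ := hβ.2

/-- The parameters of the incoming arc are in the half square. [folklore] -/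
theorem inArc_mem_rect (u : I) :
    (((1 - (u : ℝ)) * (D.jc hι hC hv hmem hω hα (i + 1)).β, (0 : ℝ)) : ℝ × ℝ) ∈
      (D.star (vtx (i + 1)) (D.nprong_vtx_ne_zero hC hv hmem hω (i + 1) (hbi := hbi))).rect := by
  have := D.outArc_mem_rect hι hC hv hmem hω hα (i + 1) (σ u)
  rwa [coe_symm_eq] at this

/-- The outgoing arc starts at the puncture. [folklore] -/
theorem outArc_zero : D.outArc hι hC hv hmem hω hα i 0 = vtx i := by
  simp only [outArc, Icc.coe_zero, zero_mul, Prod.mk_zero_zero, ProngStar.pt_zero]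

/-- The outgoing arc ends at the outgoing prong point, the start of the link. [folklore] -/
theorem outArc_one : D.outArc hι hC hv hmem hω hα i 1 = D.linkArc hι hC hv hmem hω hα i 0 := by
  simp only [outArc, linkArc, Icc.coe_one, one_mul, Path.source]
  exact ((D.jc hι hC hv hmem hω hα i).Kout.ι_base).symm

/-- The incoming arc starts at the incoming prong point, the end of the link. [folklore] -/
theorem inArc_zero : D.inArc hι hC hv hmem hω hα i 0 = D.linkArc hι hC hv hmem hω hα i 1 := by
  simp only [inArc, linkArc, Icc.coe_zero, sub_zero, one_mul, Path.target]
  exact ((D.jc hι hC hv hmem hω hα (i + 1)).Kin.ι_base).symm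

/-- The incoming arc ends at the next puncture. [folklore] -/
theorem inArc_one : D.inArc hι hC hv hmem hω hα i 1 = vtx (i + 1) := by
  simp only [inArc, Icc.coe_one, sub_self, zero_mul, Prod.mk_zero_zero, ProngStar.pt_zero]

/-- The piece starts at the puncture. [folklore] -/
theorem piece_zero : D.piece hι hC hv hmem hω hα i 0 = vtx i := by
  rw [piece, transFun_zero, transFun_zero, outArc_zero]

/-- The piece ends at the next puncture. [folklore] -/
theorem piece_one : D.piece hι hC hv hmem hω hα i 1 = vtx (i + 1) := by
  rw [piece, transFun_one, inArc_one]

/-- The outgoing arc is continuous. [folklore] -/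
theorem continuous_outArc : Continuous (D.outArc hι hC hv hmem hω hα i) :=
  ((D.star (vtx i) _).continuousOn_pt _).comp_continuous
    ((continuous_subtype_val.mul continuous_const).prodMk continuous_const) (D.outArc_mem_rect hι hC hv hmem hω hα i)

/-- The incoming arc is continuous. [folklore] -/
theorem continuous_inArc : Continuous (D.inArc hι hC hv hmem hω hα i) :=
  ((D.star (vtx (i + 1)) _).continuousOn_pt _).comp_continuous
    (((continuous_const.sub continuous_subtype_val).mul continuous_const).prodMk continuous_const)
    (D.inArc_mem_rect hι hC hv hmem hω hα i)

/-- The link arc is continuous. [folklore] -/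
theorem continuous_linkArc : Continuous (D.linkArc hι hC hv hmem hω hα i) :=
  hι.continuous.comp (D.cycℓ hι hC hv hmem hω hα i).continuous

/-- **The piece is continuous.** [folklore] -/
theorem continuous_piece : Continuous (D.piece hι hC hv hmem hω hα i) :=
  continuous_transFun (continuous_transFun (D.continuous_outArc hι hC hv hmem hω hα i) (D.continuous_linkArc hι hC hv hmem hω hα i)
    (D.outArc_one hι hC hv hmem hω hα i)) (D.continuous_inArc hι hC hv hmem hω hα i)
    (by rw [transFun_one]; exact (D.inArc_zero hι hC hv hmem hω hα i).symm)

/-! ### The arcs as leaf points -/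

/-- **Points of the outgoing arc with positive parameter are leaf points of `sx (i + 1)` at or
before the start of the link**, with prong parameter `u β`. [folklore] -/
theorem exists_outArc_eq {u : I} (hu : 0 < (u : ℝ)) :
    ∃ q : F.Leaf (sx (i + 1)), q ∈ bwd hbi (D.jc hι hC hv hmem hω hα i).Eb.p ∧ ι (Leaf.pt q) = D.outArc hι hC hv hmem hω hα i u ∧
      (D.star (vtx i) (D.nprong_vtx_ne_zero hC hv hmem hω i (hbi := hbi))).b (D.jc hι hC hv hmem hω hα i).Eb.j (ι (Leaf.pt q)) =
        (u : ℝ) * (D.jc hι hC hv hmem hω hα i).β := by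
  set E := D.jc hι hC hv hmem hω hα i
  have hb : (u : ℝ) * E.β ∈ Ioc 0 E.Eb.β₀ :=
    ⟨mul_pos hu E.hβout.1, (mul_le_of_le_one_left E.hβout.1.le u.2.2).trans E.hβout.2⟩
  obtain ⟨q, hq, hιq⟩ := E.Eb.exists_mem_bwd hι hb
  refine ⟨q, hq, hιq, ?_⟩
  rw [hιq, ProngStar.b_pt _ (D.outArc_mem_rect hι hC hv hmem hω hα i u)]

/-- **Points of the incoming arc with parameter `< 1` are leaf points of `sx (i + 1)` at or after
the end of the link**, with prong parameter `(1 - u) β'`. [folklore] -/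
theorem exists_inArc_eq {u : I} (hu : (u : ℝ) < 1) :
    ∃ q : F.Leaf (sx (i + 1)), q ∈ fwd hbi (D.jc hι hC hv hmem hω hα (i + 1)).Ef.p ∧ ι (Leaf.pt q) = D.inArc hι hC hv hmem hω hα i u ∧
      (D.star (vtx (i + 1)) (D.nprong_vtx_ne_zero hC hv hmem hω (i + 1) (hbi := hbi))).b (D.jc hι hC hv hmem hω hα (i + 1)).Ef.j
        (ι (Leaf.pt q)) = (1 - (u : ℝ)) * (D.jc hι hC hv hmem hω hα (i + 1)).β := by
  set E := D.jc hι hC hv hmem hω hα (i + 1)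
  have hb : (1 - (u : ℝ)) * E.β ∈ Ioc 0 E.Ef.β₀ :=
    ⟨mul_pos (by linarith) E.hβin.1, (mul_le_of_le_one_left E.hβin.1.le (by linarith [u.2.1])).trans E.hβin.2⟩
  obtain ⟨q, hq, hιq⟩ := E.Ef.exists_mem_fwd hι hb
  refine ⟨q, hq, hιq, ?_⟩
  rw [hιq, ProngStar.b_pt _ (D.inArc_mem_rect hι hC hv hmem hω hα i u)]

/-- Points of the link arc are leaf points of `sx (i + 1)` in the closed leaf interval of the
link. [folklore] -/
theorem exists_linkArc_eq (u : I) :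
    ∃ r ∈ leafIcc hbi (D.linkStart hι hC hv hmem hω hα i) (D.linkEnd hι hC hv hmem hω hα i), ι (Leaf.pt r) = D.linkArc hι hC hv hmem hω hα i u := by
  obtain ⟨r, hr, hreq⟩ := (D.mem_range_cycℓ_iff hι hC hv hmem hω hα i).1 ⟨u, rfl⟩
  exact ⟨r, hr, by rw [hreq]; rfl⟩

/-- The prong parameter of the start of the link. [folklore] -/
theorem b_linkStart :
    (D.star (vtx i) (D.nprong_vtx_ne_zero hC hv hmem hω i (hbi := hbi))).b (D.jc hι hC hv hmem hω hα i).Eb.j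
      (ι (Leaf.pt (D.linkStart hι hC hv hmem hω hα i))) = (D.jc hι hC hv hmem hω hα i).β := by
  rw [(D.linkStart_spec hι hC hv hmem hω hα i).2, ProngStar.b_pt]
  simpa using D.outArc_mem_rect hι hC hv hmem hω hα i 1

/-- The prong parameter of the end of the link. [folklore] -/
theorem b_linkEnd :
    (D.star (vtx (i + 1)) (D.nprong_vtx_ne_zero hC hv hmem hω (i + 1) (hbi := hbi))).b (D.jc hι hC hv hmem hω hα (i + 1)).Ef.j
      (ι (Leaf.pt (D.linkEnd hι hC hv hmem hω hα i))) = (D.jc hι hC hv hmem hω hα (i + 1)).β := by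
  rw [(D.linkEnd_spec hι hC hv hmem hω hα i).2, ProngStar.b_pt]
  simpa using D.outArc_mem_rect hι hC hv hmem hω hα (i + 1) 1

include D hv in
omit [T2Space X] [SecondCountableTopology X] [Nonempty X] [NeZero m] hnc in
/-- The punctures are off the domain. [folklore] -/
theorem vtx_ne_ι (k : Fin m) (y : X) : ι y ≠ vtx k := fun h ↦ by
  have : vtx k ∈ range ι := ⟨y, h⟩
  rw [D.range_eq] at this
  exact this.2 (hv k)

/-! ### Meetings of the arcs of one piece -/

/-- **The outgoing arc meets the link only at its end.** [folklore] -/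
theorem outArc_eq_linkArc {u u' : I} (h : D.outArc hι hC hv hmem hω hα i u = D.linkArc hι hC hv hmem hω hα i u') : u = 1 ∧ u' = 0 := by
  set E := D.jc hι hC hv hmem hω hα i with hE
  have hαi : vtx i ∈ alphaSet hbi ι (sx (i + 1)) := by rw [hα i]; exact mem_singleton _
  rcases eq_or_lt_of_le u.2.1 with hu | hu
  · -- `u = 0`: the puncture is not a point of the link
    exfalso
    have h0 : D.outArc hι hC hv hmem hω hα i u = vtx i := by
      rw [show u = 0 from Subtype.ext hu.symm]; exact D.outArc_zero hι hC hv hmem hω hα i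
    exact D.vtx_ne_ι hv i _ (h.symm.trans h0)
  obtain ⟨q, hq, hιq, hbq⟩ := D.exists_outArc_eq hι hC hv hmem hω hα i hu
  obtain ⟨r, hr, hιr⟩ := D.exists_linkArc_eq hι hC hv hmem hω hα i u'
  have hqr : q = r := Leaf.injective_coe F _ (hι.injective (hιq.trans (h.trans hιr.symm)))
  subst hqr
  -- `linkStart ≤ q` and both in the backward tail: `β ≤ u β`, so `u = 1`
  have hS := D.linkStart_spec hι hC hv hmem hω hα i
  have hnot : ¬ leafLT hbi q (D.linkStart hι hC hv hmem hω hα i) := hr.1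
  have hle : E.β ≤ (u : ℝ) * E.β := by
    have := (E.Eb.leafLT_iff_b_lt hι hαi hS.1 hq).not.1 hnot
    rw [hbq, D.b_linkStart hι hC hv hmem hω hα i] at this
    exact not_lt.1 this
  have hu1 : (u : ℝ) = 1 := by
    have h1 : 1 ≤ (u : ℝ) := by
      by_contra hlt
      have : (u : ℝ) * E.β < 1 * E.β := mul_lt_mul_of_pos_right (not_le.1 hlt) E.hβout.1
      linarith
    exact le_antisymm u.2.2 h1
  have hu1' : u = 1 := Subtype.ext hu1
  refine ⟨hu1', ?_⟩
  -- then `q = linkStart` and `u' = 0` by injectivity of the link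
  have hqs : q = D.linkStart hι hC hv hmem hω hα i :=
    E.Eb.eq_of_b_eq hι hq hS.1 (by rw [hbq, hu1, one_mul, D.b_linkStart hι hC hv hmem hω hα i])
  apply D.injective_cycℓ hι hC hv hmem hω hα i
  apply hι.injective
  show D.linkArc hι hC hv hmem hω hα i u' = D.linkArc hι hC hv hmem hω hα i 0
  rw [← hιr, hqs, hS.2, linkArc, Path.source]
  exact ((D.jc hι hC hv hmem hω hα i).Kout.ι_base).symm

/-- **The link meets the incoming arc only at its end.** [folklore] -/
theorem linkArc_eq_inArc {u u' : I} (h : D.linkArc hι hC hv hmem hω hα i u = D.inArc hι hC hv hmem hω hα i u') : u = 1 ∧ u' = 0 := by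
  set E := D.jc hι hC hv hmem hω hα (i + 1) with hE
  have hωi : vtx (i + 1) ∈ omegaSet hbi ι (sx (i + 1)) := by rw [hω (i + 1)]; exact mem_singleton _
  rcases eq_or_lt_of_le u'.2.2 with hu' | hu'
  · exfalso
    have h1 : D.inArc hι hC hv hmem hω hα i u' = vtx (i + 1) := by
      rw [show u' = 1 from Subtype.ext hu']; exact D.inArc_one hι hC hv hmem hω hα i
    exact D.vtx_ne_ι hv (i + 1) _ (h.trans h1)
  obtain ⟨q, hq, hιq, hbq⟩ := D.exists_inArc_eq hι hC hv hmem hω hα i hu'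
  obtain ⟨r, hr, hιr⟩ := D.exists_linkArc_eq hι hC hv hmem hω hα i u
  have hqr : q = r := Leaf.injective_coe F _ (hι.injective (hιq.trans (h.symm.trans hιr.symm)))
  subst hqr
  -- `q ≤ linkEnd` and both in the forward tail: `β' ≤ (1 - u') β'`, so `u' = 0`
  have hS := D.linkEnd_spec hι hC hv hmem hω hα i
  have hnot : ¬ leafLT hbi (D.linkEnd hι hC hv hmem hω hα i) q := hr.2
  have hle : E.β ≤ (1 - (u' : ℝ)) * E.β := by
    have := (E.Ef.leafLT_iff_b_lt hι hωi hS.1 hq).not.1 hnot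
    rw [hbq, D.b_linkEnd hι hC hv hmem hω hα i] at this
    exact not_lt.1 this
  have hu0 : (u' : ℝ) = 0 := by
    have h1 : (u' : ℝ) ≤ 0 := by
      by_contra hlt
      have : (1 - (u' : ℝ)) * E.β < 1 * E.β := mul_lt_mul_of_pos_right (by linarith [not_le.1 hlt]) E.hβin.1
      linarith
    exact le_antisymm h1 u'.2.1
  have hu0' : u' = 0 := Subtype.ext hu0
  refine ⟨?_, hu0'⟩
  have hqs : q = D.linkEnd hι hC hv hmem hω hα i :=
    E.Ef.eq_of_b_eq hι hq hS.1 (by rw [hbq, hu0, sub_zero, one_mul, D.b_linkEnd hι hC hv hmem hω hα i])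
  apply D.injective_cycℓ hι hC hv hmem hω hα i
  apply hι.injective
  show D.linkArc hι hC hv hmem hω hα i u = D.linkArc hι hC hv hmem hω hα i 1
  rw [← hιr, hqs, hS.2, linkArc, Path.target]
  exact ((D.jc hι hC hv hmem hω hα (i + 1)).Kin.ι_base).symm

/-- **The outgoing arc meets the incoming arc only when the piece closes up** (`u = 0`,
`u' = 1`, and then `vtx i = vtx (i + 1)`). [folklore] -/
theorem outArc_eq_inArc {u u' : I} (h : D.outArc hι hC hv hmem hω hα i u = D.inArc hι hC hv hmem hω hα i u') : u = 0 ∧ u' = 1 := by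
  have hαi : vtx i ∈ alphaSet hbi ι (sx (i + 1)) := by rw [hα i]; exact mem_singleton _
  have hωi : vtx (i + 1) ∈ omegaSet hbi ι (sx (i + 1)) := by rw [hω (i + 1)]; exact mem_singleton _
  rcases eq_or_lt_of_le u.2.1 with hu | hu
  · have hu0 : u = 0 := Subtype.ext hu.symm
    refine ⟨hu0, ?_⟩
    rcases eq_or_lt_of_le u'.2.2 with hu' | hu'
    · exact Subtype.ext hu'
    · exfalso
      obtain ⟨q, -, hιq, -⟩ := D.exists_inArc_eq hι hC hv hmem hω hα i hu'
      rw [hu0, D.outArc_zero hι hC hv hmem hω hα i] at h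
      exact D.vtx_ne_ι hv i _ (hιq.trans h.symm)
  · exfalso
    rcases eq_or_lt_of_le u'.2.2 with hu' | hu'
    · obtain ⟨q, -, hιq, -⟩ := D.exists_outArc_eq hι hC hv hmem hω hα i hu
      rw [show u' = 1 from Subtype.ext hu', D.inArc_one hι hC hv hmem hω hα i] at h
      exact D.vtx_ne_ι hv (i + 1) _ (hιq.trans h)
    · -- both are leaf points: before `linkStart` and after `linkEnd`
      obtain ⟨q, hq, hιq, hbq⟩ := D.exists_outArc_eq hι hC hv hmem hω hα i hu
      obtain ⟨q', hq', hιq', hbq'⟩ := D.exists_inArc_eq hι hC hv hmem hω hα i hu'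
      have hqq : q = q' := Leaf.injective_coe F _ (hι.injective (hιq.trans (h.trans hιq'.symm)))
      subst hqq
      have hS := D.linkStart_spec hι hC hv hmem hω hα i
      have hS' := D.linkEnd_spec hι hC hv hmem hω hα i
      -- `q ≤ linkStart < linkEnd ≤ q`
      have h1 : ¬ leafLT hbi (D.linkStart hι hC hv hmem hω hα i) q := by
        rw [(D.jc hι hC hv hmem hω hα i).Eb.leafLT_iff_b_lt hι hαi hq hS.1, hbq, D.b_linkStart hι hC hv hmem hω hα i, not_lt]
        exact mul_le_of_le_one_left (D.jc hι hC hv hmem hω hα i).hβout.1.le u.2.2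
      have h2 : ¬ leafLT hbi q (D.linkEnd hι hC hv hmem hω hα i) := by
        rw [(D.jc hι hC hv hmem hω hα (i + 1)).Ef.leafLT_iff_b_lt hι hωi hq' hS'.1, hbq', D.b_linkEnd hι hC hv hmem hω hα i, not_lt]
        exact mul_le_of_le_one_left (D.jc hι hC hv hmem hω hα (i + 1)).hβin.1.le (by linarith [u'.2.1])
      have h3 := D.linkStart_lt_linkEnd hι hC hv hmem hω hα i
      rcases not_leafLT_iff.1 h1 with h1 | h1
      · rcases not_leafLT_iff.1 h2 with h2 | h2
        · exact leafLT_asymm h3 (leafLT_trans h2 h1)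
        · rw [h2] at h3; exact leafLT_asymm h3 h1
      · rw [← h1] at h3
        rcases not_leafLT_iff.1 h2 with h2 | h2
        · exact leafLT_asymm h3 h2
        · rw [h2] at h3; exact leafLT_irrefl _ h3

/-- The outgoing arc is injective. [folklore] -/
theorem injective_outArc : Injective (D.outArc hι hC hv hmem hω hα i) := fun u u' h ↦ by
  have h' := (D.star (vtx i) _).pt_injOn _ (D.outArc_mem_rect hι hC hv hmem hω hα i u) (D.outArc_mem_rect hι hC hv hmem hω hα i u') h
  have hβ := (D.jc hι hC hv hmem hω hα i).hβout.1
  have := congrArg Prod.fst h'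
  exact Subtype.ext (mul_right_cancel₀ hβ.ne' this)

/-- The incoming arc is injective. [folklore] -/
theorem injective_inArc : Injective (D.inArc hι hC hv hmem hω hα i) := fun u u' h ↦ by
  have h' := (D.star (vtx (i + 1)) _).pt_injOn _ (D.inArc_mem_rect hι hC hv hmem hω hα i u) (D.inArc_mem_rect hι hC hv hmem hω hα i u') h
  have hβ := (D.jc hι hC hv hmem hω hα (i + 1)).hβin.1
  have := congrArg Prod.fst h'
  have := mul_right_cancel₀ hβ.ne' this
  exact Subtype.ext (by linarith)

/-- The link arc is injective. [folklore] -/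
theorem injective_linkArc : Injective (D.linkArc hι hC hv hmem hω hα i) :=
  hι.injective.comp (D.injective_cycℓ hι hC hv hmem hω hα i)

/-- **Equal values of a piece come from equal parameters, or from its two ends** (when the piece
closes up). [folklore] -/
theorem piece_eq_piece_imp {θ θ' : I} (h : D.piece hι hC hv hmem hω hα i θ = D.piece hι hC hv hmem hω hα i θ') :
    θ = θ' ∨ (θ = 0 ∧ θ' = 1) ∨ (θ = 1 ∧ θ' = 0) := by
  have hinner : Injective (transFun (D.outArc hι hC hv hmem hω hα i) (D.linkArc hι hC hv hmem hω hα i)) :=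
    injective_transFun (D.injective_outArc hι hC hv hmem hω hα i) (D.injective_linkArc hι hC hv hmem hω hα i)
      fun a b hab ↦ D.outArc_eq_linkArc hι hC hv hmem hω hα i hab
  have key := transFun_eq_transFun_imp hinner (D.injective_inArc hι hC hv hmem hω hα i) (fun a b hab ↦ ?_) h
  · rcases key with h1 | ⟨h0, h1⟩ | ⟨h1, h0⟩
    · exact Or.inl h1
    · exact Or.inr (Or.inl ⟨h0, h1⟩)
    · exact Or.inr (Or.inr ⟨h1, h0⟩)
  · -- a meeting of the first two arcs with the incoming arc
    unfold transFun at hab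
    split_ifs at hab with ha
    · -- outgoing arc meets incoming arc: the ends
      obtain ⟨h0, h1⟩ := D.outArc_eq_inArc hι hC hv hmem hω hα i hab
      right
      refine ⟨Subtype.ext ?_, h1⟩
      have := congrArg (fun c : I ↦ (c : ℝ)) h0
      simp only [coe_fstHalf ha] at this
      simpa using this
    · -- link meets incoming arc: the junction
      obtain ⟨h1, h0⟩ := D.linkArc_eq_inArc hι hC hv hmem hω hα i hab
      left
      refine ⟨Subtype.ext ?_, h0⟩
      have := congrArg (fun c : I ↦ (c : ℝ)) h1
      simp only [coe_sndHalf (not_le.1 ha).le] at this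
      norm_num at this
      show (a : ℝ) = 1
      linarith

/-- **The values of a piece**: the puncture `vtx i` at `θ = 0`, the puncture `vtx (i + 1)` at
`θ = 1`, and points of the image of the leaf of `sx (i + 1)` in between. [folklore] -/
theorem piece_mem (θ : I) (h0 : θ ≠ 0) (h1 : θ ≠ 1) : D.piece hι hC hv hmem hω hα i θ ∈ ι '' F.leaf (sx (i + 1)) := by
  unfold piece transFun
  split_ifs with ha hb
  · -- outgoing arc, positive parameter
    have hu : 0 < ((fstHalf (fstHalf θ) : I) : ℝ) := by
      rw [coe_fstHalf hb, coe_fstHalf ha]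
      have : (0 : ℝ) < θ := lt_of_le_of_ne θ.2.1 (fun h ↦ h0 (Subtype.ext h.symm))
      linarith
    obtain ⟨q, -, hιq, -⟩ := D.exists_outArc_eq hι hC hv hmem hω hα i hu
    exact ⟨Leaf.pt q, q.2, hιq⟩
  · obtain ⟨r, -, hιr⟩ := D.exists_linkArc_eq hι hC hv hmem hω hα i (sndHalf (fstHalf θ))
    exact ⟨Leaf.pt r, r.2, hιr⟩
  · have hu : ((sndHalf θ : I) : ℝ) < 1 := by
      rw [coe_sndHalf (not_le.1 ha).le]
      have : (θ : ℝ) < 1 := lt_of_le_of_ne θ.2.2 (fun h ↦ h1 (Subtype.ext h))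
      linarith
    obtain ⟨q, -, hιq, -⟩ := D.exists_inArc_eq hι hC hv hmem hω hα i hu
    exact ⟨Leaf.pt q, q.2, hιq⟩

end Piece

/-! ## The polygon: all pieces concatenated -/

section Polygon

/-- **The first `k + 1` pieces of the polygon, concatenated.** [folklore] -/
def polyTrace : ℕ → I → ℂ
  | 0 => D.piece hι hC hv hmem hω hα (idx m 0)
  | k + 1 => transFun (polyTrace k) (D.piece hι hC hv hmem hω hα (idx m (k + 1)))

/-- The unfolding of the recursion. [folklore] -/
theorem polyTrace_succ (k : ℕ) :
    D.polyTrace hι hC hv hmem hω hα (k + 1) = transFun (D.polyTrace hι hC hv hmem hω hα k) (D.piece hι hC hv hmem hω hα (idx m (k + 1))) := rfl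

/-- The concatenation starts at `vtx 0`. [folklore] -/
theorem polyTrace_zero_apply (k : ℕ) : D.polyTrace hι hC hv hmem hω hα k 0 = vtx (idx m 0) := by
  induction k with
  | zero => exact D.piece_zero hι hC hv hmem hω hα _
  | succ k ih => rw [polyTrace_succ, transFun_zero, ih]

/-- The concatenation of `k + 1` pieces ends at `vtx (k + 1)`. [folklore] -/
theorem polyTrace_one_apply (k : ℕ) : D.polyTrace hι hC hv hmem hω hα k 1 = vtx (idx m (k + 1)) := by
  cases k with
  | zero => rw [show D.polyTrace hι hC hv hmem hω hα 0 = D.piece hι hC hv hmem hω hα (idx m 0) from rfl, piece_one, ← idx_succ]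
  | succ k => rw [polyTrace_succ, transFun_one, piece_one, ← idx_succ]

/-- **The concatenation is continuous.** [folklore] -/
theorem continuous_polyTrace (k : ℕ) : Continuous (D.polyTrace hι hC hv hmem hω hα k) := by
  induction k with
  | zero => exact D.continuous_piece hι hC hv hmem hω hα _
  | succ k ih =>
    rw [polyTrace_succ]
    exact continuous_transFun ih (D.continuous_piece hι hC hv hmem hω hα _) (by rw [polyTrace_one_apply, piece_zero])

/-- **The values of the concatenation**: the start `vtx 0`, or a point of one of its pieces off
their starts (a leaf point of `sx (j + 1)` or the puncture `vtx (j + 1)`, `j ≤ k`). [folklore] -/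
theorem polyTrace_cases (k : ℕ) (θ : I) : θ = 0 ∨ ∃ j ≤ k,
    D.polyTrace hι hC hv hmem hω hα k θ ∈ ι '' F.leaf (sx (idx m j + 1)) ∨ D.polyTrace hι hC hv hmem hω hα k θ = vtx (idx m (j + 1)) := by
  induction k generalizing θ with
  | zero =>
    by_cases h0 : θ = 0
    · exact Or.inl h0
    by_cases h1 : θ = 1
    · refine Or.inr ⟨0, le_rfl, Or.inr ?_⟩
      rw [h1]; exact D.polyTrace_one_apply hι hC hv hmem hω hα 0
    · exact Or.inr ⟨0, le_rfl, Or.inl (D.piece_mem hι hC hv hmem hω hα _ θ h0 h1)⟩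
  | succ k ih =>
    rw [polyTrace_succ]
    by_cases hθ : (θ : ℝ) ≤ 1 / 2
    · rw [transFun_apply_of_le hθ]
      rcases ih (fstHalf θ) with h | ⟨j, hj, h⟩
      · left
        apply Subtype.ext
        have := congrArg (fun c : I ↦ (c : ℝ)) h
        simp only [coe_fstHalf hθ] at this
        simpa using this
      · exact Or.inr ⟨j, hj.trans (Nat.le_succ k), h⟩
    · rw [transFun_apply_of_lt (not_le.1 hθ)]
      right
      refine ⟨k + 1, le_rfl, ?_⟩
      by_cases h1 : sndHalf θ = 1
      · right; rw [h1, piece_one, ← idx_succ]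
      · have h0 : sndHalf θ ≠ 0 := fun h ↦ by
          have := congrArg (fun c : I ↦ (c : ℝ)) h
          simp only [coe_sndHalf (not_le.1 hθ).le] at this
          norm_num at this
          linarith [not_le.1 hθ]
        exact Or.inl (D.piece_mem hι hC hv hmem hω hα _ _ h0 h1)

variable (hvtx : Injective vtx) (hsx : ∀ a b, F.leaf (sx a) = F.leaf (sx b) → a = b)

omit [NeZero m] in
/-- The index is injective below `m`. [folklore] -/
theorem idx_injOn [NeZero m] {a b : ℕ} (ha : a < m) (hb : b < m) (h : idx m a = idx m b) : a = b := by
  have := congrArg Fin.val h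
  simp only [idx_val, Nat.mod_eq_of_lt ha, Nat.mod_eq_of_lt hb] at this
  exact this

include hsx in
omit [T2Space X] [SecondCountableTopology X] [Nonempty X] [NeZero m] hnc in
/-- **Different separatrices of a simple cycle have disjoint images.** [folklore] -/
theorem eq_of_mem_image_leaf [NeZero m] (hιi : Injective ι) {a b : Fin m} {z : ℂ} (ha : z ∈ ι '' F.leaf (sx a)) (hb : z ∈ ι '' F.leaf (sx b)) :
    a = b := by
  obtain ⟨y, hy, rfl⟩ := ha
  obtain ⟨y', hy', hyy⟩ := hb
  have : y' = y := hιi hyy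
  subst this
  exact hsx a b ((leaf_eq_of_mem hy).symm.trans (leaf_eq_of_mem hy'))

include hvtx in
/-- **A piece of a simple cycle with at least two separatrices is injective.** [folklore] -/
theorem injective_piece (hm : 1 < m) (i : Fin m) : Injective (D.piece hι hC hv hmem hω hα i) := by
  intro θ θ' h
  rcases D.piece_eq_piece_imp hι hC hv hmem hω hα i h with h1 | ⟨h0, h1⟩ | ⟨h1, h0⟩
  · exact h1
  · exfalso
    rw [h0, h1, piece_zero, piece_one] at h
    have : i = i + 1 := hvtx h
    have h2 := congrArg Fin.val this
    rw [Fin.val_add, Fin.val_one', Nat.mod_eq_of_lt hm] at h2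
    rcases lt_or_ge (i.val + 1) m with h3 | h3
    · rw [Nat.mod_eq_of_lt h3] at h2; omega
    · have : i.val + 1 = m := le_antisymm i.2 h3
      rw [this, Nat.mod_self] at h2; omega
  · exfalso
    rw [h0, h1, piece_zero, piece_one] at h
    have : i = i + 1 := hvtx h.symm
    have h2 := congrArg Fin.val this
    rw [Fin.val_add, Fin.val_one', Nat.mod_eq_of_lt hm] at h2
    rcases lt_or_ge (i.val + 1) m with h3 | h3
    · rw [Nat.mod_eq_of_lt h3] at h2; omega
    · have : i.val + 1 = m := le_antisymm i.2 h3
      rw [this, Nat.mod_self] at h2; omega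

include hvtx hsx in
/-- **The concatenation of fewer than all the pieces is injective, and hits its two end punctures
only at its ends.** [folklore] -/
theorem polyTrace_inj (k : ℕ) (hk : k + 1 < m) :
    Injective (D.polyTrace hι hC hv hmem hω hα k) ∧
      (∀ θ, D.polyTrace hι hC hv hmem hω hα k θ = vtx (idx m (k + 1)) → θ = 1) ∧
      (∀ θ, D.polyTrace hι hC hv hmem hω hα k θ = vtx (idx m 0) → θ = 0) := by
  have hm : 1 < m := by omega
  induction k with
  | zero =>
    have hinj := D.injective_piece hι hC hv hmem hω hα hvtx hm (idx m 0)
    refine ⟨hinj, fun θ h ↦ hinj ?_, fun θ h ↦ hinj ?_⟩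
    · show D.polyTrace hι hC hv hmem hω hα 0 θ = D.polyTrace hι hC hv hmem hω hα 0 1
      rw [h]; exact (D.polyTrace_one_apply hι hC hv hmem hω hα 0).symm
    · show D.polyTrace hι hC hv hmem hω hα 0 θ = D.polyTrace hι hC hv hmem hω hα 0 0
      rw [h]; exact (D.polyTrace_zero_apply hι hC hv hmem hω hα 0).symm
  | succ k ih =>
    obtain ⟨ihinj, ihend, ihstart⟩ := ih (by omega)
    -- values of the first part are not `vtx (k + 2)`, values off the start are not `vtx 0`
    have hval : ∀ θ, D.polyTrace hι hC hv hmem hω hα k θ ≠ vtx (idx m (k + 2)) := by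
      intro θ h
      rcases D.polyTrace_cases hι hC hv hmem hω hα k θ with h0 | ⟨j, hj, hθ⟩
      · rw [h0, polyTrace_zero_apply] at h
        have := idx_injOn (by omega) hk (hvtx h); omega
      · rcases hθ with hθ | hθ
        · rw [h] at hθ; obtain ⟨y, -, hy⟩ := hθ; exact D.vtx_ne_ι hv _ _ hy
        · rw [hθ] at h
          have := idx_injOn (by omega) hk (hvtx h); omega
    -- meetings of the first part with the new piece
    have hmeet : ∀ θ θ', D.polyTrace hι hC hv hmem hω hα k θ = D.piece hι hC hv hmem hω hα (idx m (k + 1)) θ' →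
        (θ = 1 ∧ θ' = 0) ∨ (θ = 0 ∧ θ' = 1) := by
      intro θ θ' h
      by_cases h0' : θ' = 0
      · rw [h0', piece_zero] at h
        exact Or.inl ⟨ihend θ h, h0'⟩
      by_cases h1' : θ' = 1
      · exfalso
        rw [h1', piece_one, ← idx_succ] at h
        exact hval θ h
      · exfalso
        have hleaf := D.piece_mem hι hC hv hmem hω hα (idx m (k + 1)) θ' h0' h1'
        rw [← h] at hleaf
        rcases D.polyTrace_cases hι hC hv hmem hω hα k θ with h0 | ⟨j, hj, hθ⟩
        · rw [h0, polyTrace_zero_apply] at hleaf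
          obtain ⟨y, -, hy⟩ := hleaf; exact D.vtx_ne_ι hv _ _ hy
        · rcases hθ with hθ | hθ
          · have := eq_of_mem_image_leaf hsx hι.injective hθ hleaf
            rw [← idx_succ, ← idx_succ] at this
            have := idx_injOn (by omega) (by omega) this; omega
          · rw [hθ] at hleaf
            obtain ⟨y, -, hy⟩ := hleaf; exact D.vtx_ne_ι hv _ _ hy
    have hinj' := D.injective_piece hι hC hv hmem hω hα hvtx hm (idx m (k + 1))
    refine ⟨?_, fun θ h ↦ ?_, fun θ h ↦ ?_⟩
    · -- injective
      intro θ θ' h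
      rw [polyTrace_succ] at h
      rcases transFun_eq_transFun_imp ihinj hinj' hmeet h with h1 | ⟨h0, h1⟩ | ⟨h1, h0⟩
      · exact h1
      · exfalso
        rw [h0, h1, ← polyTrace_succ, polyTrace_zero_apply, polyTrace_one_apply] at h
        have := idx_injOn (by omega) hk (hvtx h); omega
      · exfalso
        rw [h0, h1, ← polyTrace_succ, polyTrace_zero_apply, polyTrace_one_apply] at h
        have := idx_injOn hk (by omega) (hvtx h); omega
    · -- the end puncture only at the end
      rw [polyTrace_succ] at h
      by_cases hθ : (θ : ℝ) ≤ 1 / 2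
      · rw [transFun_apply_of_le hθ] at h
        exact absurd h (hval _)
      · rw [transFun_apply_of_lt (not_le.1 hθ), idx_succ (k + 1), ← D.piece_one hι hC hv hmem hω hα] at h
        have h1 := hinj' h
        apply Subtype.ext
        have := congrArg (fun c : I ↦ (c : ℝ)) h1
        simp only [coe_sndHalf (not_le.1 hθ).le] at this
        norm_num at this
        show (θ : ℝ) = 1
        linarith
    · -- the start puncture only at the start
      rw [polyTrace_succ] at h
      by_cases hθ : (θ : ℝ) ≤ 1 / 2
      · rw [transFun_apply_of_le hθ] at h
        have h0 := ihstart _ h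
        apply Subtype.ext
        have := congrArg (fun c : I ↦ (c : ℝ)) h0
        simp only [coe_fstHalf hθ] at this
        simpa using this
      · exfalso
        rw [transFun_apply_of_lt (not_le.1 hθ)] at h
        -- a value of the new piece is `vtx 0`: its start `vtx (k+1)`, its end `vtx (k+2)`, or a leaf point
        by_cases h0' : sndHalf θ = 0
        · rw [h0', piece_zero] at h
          have := idx_injOn (by omega) (by omega) (hvtx h); omega
        by_cases h1' : sndHalf θ = 1
        · rw [h1', piece_one, ← idx_succ] at h
          have := idx_injOn hk (by omega) (hvtx h); omega
        · have hleaf := D.piece_mem hι hC hv hmem hω hα (idx m (k + 1)) _ h0' h1'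
          rw [h] at hleaf
          obtain ⟨y, -, hy⟩ := hleaf; exact D.vtx_ne_ι hv _ _ hy

include hvtx hsx in
/-- **Equal values of the whole polygon come from equal parameters or from its two ends.**
[folklore] -/
theorem polyTrace_eq_imp {k : ℕ} (hk : k + 1 = m) {θ θ' : I}
    (h : D.polyTrace hι hC hv hmem hω hα k θ = D.polyTrace hι hC hv hmem hω hα k θ') :
    θ = θ' ∨ (θ = 0 ∧ θ' = 1) ∨ (θ = 1 ∧ θ' = 0) := by
  cases k with
  | zero => exact D.piece_eq_piece_imp hι hC hv hmem hω hα _ h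
  | succ k =>
    have hm : 1 < m := by omega
    obtain ⟨ihinj, ihend, ihstart⟩ := D.polyTrace_inj hι hC hv hmem hω hα hvtx hsx k (by omega)
    have hinj' := D.injective_piece hι hC hv hmem hω hα hvtx hm (idx m (k + 1))
    rw [polyTrace_succ] at h
    refine transFun_eq_transFun_imp ihinj hinj' (fun a b hab ↦ ?_) h
    by_cases h0' : b = 0
    · rw [h0', piece_zero] at hab
      exact Or.inl ⟨ihend a hab, h0'⟩
    by_cases h1' : b = 1
    · rw [h1', piece_one, ← idx_succ, hk, show idx m m = idx m 0 from idx_self] at hab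
      exact Or.inr ⟨ihstart a hab, h1'⟩
    · exfalso
      have hleaf := D.piece_mem hι hC hv hmem hω hα (idx m (k + 1)) b h0' h1'
      rw [← hab] at hleaf
      rcases D.polyTrace_cases hι hC hv hmem hω hα k a with h0 | ⟨j, hj, hθ⟩
      · rw [h0, polyTrace_zero_apply] at hleaf
        obtain ⟨y, -, hy⟩ := hleaf; exact D.vtx_ne_ι hv _ _ hy
      · rcases hθ with hθ | hθ
        · have := eq_of_mem_image_leaf hsx hι.injective hθ hleaf
          rw [← idx_succ, ← idx_succ, hk, show idx m m = idx m 0 from idx_self] at this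
          have := idx_injOn (by omega) (by omega) this; omega
        · rw [hθ] at hleaf
          obtain ⟨y, -, hy⟩ := hleaf; exact D.vtx_ne_ι hv _ _ hy

/-- **The polygon of the cycle as a `1`-periodic loop.** [folklore] -/
def polyLoop : ℝ → ℂ := (fun t ↦ D.polyTrace hι hC hv hmem hω hα (m - 1) (projIcc 0 1 zero_le_one t)) ∘ Int.fract

/-- The polygon closes up. [folklore] -/
theorem polyTrace_zero_eq_one : D.polyTrace hι hC hv hmem hω hα (m - 1) 0 = D.polyTrace hι hC hv hmem hω hα (m - 1) 1 := by
  rw [polyTrace_zero_apply, polyTrace_one_apply, Nat.sub_add_cancel (Nat.pos_of_neZero m), show idx m m = idx m 0 from idx_self]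

/-- On `[0, 1]` the polygon loop is the concatenation of the pieces. [folklore] -/
theorem polyLoop_apply_of_mem {t : ℝ} (ht : t ∈ Icc (0 : ℝ) 1) :
    D.polyLoop hι hC hv hmem hω hα t = D.polyTrace hι hC hv hmem hω hα (m - 1) (projIcc 0 1 zero_le_one t) := by
  refine comp_fract_apply_of_mem_Icc (f := fun t ↦ D.polyTrace hι hC hv hmem hω hα (m - 1) (projIcc 0 1 zero_le_one t)) ?_ ht
  show D.polyTrace hι hC hv hmem hω hα (m - 1) (projIcc 0 1 zero_le_one 0) = D.polyTrace hι hC hv hmem hω hα (m - 1) (projIcc 0 1 zero_le_one 1)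
  rw [projIcc_left, projIcc_right]
  exact D.polyTrace_zero_eq_one hι hC hv hmem hω hα

include hvtx hsx in
/-- **The polygon of a simple cycle of separatrices is a Jordan loop.** [cite: CamachoLinsNeto1985, Ch. VII §2] -/
theorem isJordanLoop_polyLoop : IsJordanLoop (D.polyLoop hι hC hv hmem hω hα) where
  continuous := by
    refine ContinuousOn.comp_fract'' ((D.continuous_polyTrace hι hC hv hmem hω hα _).comp continuous_projIcc).continuousOn ?_
    show D.polyTrace hι hC hv hmem hω hα (m - 1) (projIcc 0 1 zero_le_one 0) = D.polyTrace hι hC hv hmem hω hα (m - 1) (projIcc 0 1 zero_le_one 1)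
    rw [projIcc_left, projIcc_right]
    exact D.polyTrace_zero_eq_one hι hC hv hmem hω hα
  periodic := periodic_comp_fract
  injOn s hs t ht hst := by
    rw [D.polyLoop_apply_of_mem hι hC hv hmem hω hα ⟨hs.1, hs.2.le⟩, D.polyLoop_apply_of_mem hι hC hv hmem hω hα ⟨ht.1, ht.2.le⟩] at hst
    have hk : m - 1 + 1 = m := Nat.sub_add_cancel (Nat.pos_of_neZero m)
    rcases D.polyTrace_eq_imp hι hC hv hmem hω hα hvtx hsx hk hst with h | ⟨-, h1⟩ | ⟨h1, -⟩
    · have := congrArg (fun c : I ↦ (c : ℝ)) h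
      simp only [projIcc_of_mem _ ⟨hs.1, hs.2.le⟩, projIcc_of_mem _ ⟨ht.1, ht.2.le⟩] at this
      exact this
    · exfalso
      have := congrArg (fun c : I ↦ (c : ℝ)) h1
      simp only [projIcc_of_mem _ ⟨ht.1, ht.2.le⟩] at this
      simp at this
      linarith [ht.2]
    · exfalso
      have := congrArg (fun c : I ↦ (c : ℝ)) h1
      simp only [projIcc_of_mem _ ⟨hs.1, hs.2.le⟩] at this
      simp at this
      linarith [hs.2]

/-- **The range of the polygon loop**: the punctures and the pieces. [folklore] -/
theorem range_polyLoop : range (D.polyLoop hι hC hv hmem hω hα) = range (D.polyTrace hι hC hv hmem hω hα (m - 1)) := by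
  apply Subset.antisymm
  · rintro _ ⟨t, rfl⟩
    exact ⟨_, rfl⟩
  · rintro _ ⟨θ, rfl⟩
    refine ⟨θ, ?_⟩
    rw [D.polyLoop_apply_of_mem hι hC hv hmem hω hα θ.2, projIcc_val]

/-- **The range of the concatenation**: the pieces so far. [folklore] -/
theorem range_polyTrace_succ (k : ℕ) :
    range (D.polyTrace hι hC hv hmem hω hα (k + 1)) = range (D.polyTrace hι hC hv hmem hω hα k) ∪ range (D.piece hι hC hv hmem hω hα (idx m (k + 1))) := by
  rw [polyTrace_succ, range_transFun_eq]
  rw [polyTrace_one_apply, piece_zero]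

/-- The ranges of the concatenations increase. [folklore] -/
theorem range_polyTrace_mono {j k : ℕ} (h : j ≤ k) : range (D.polyTrace hι hC hv hmem hω hα j) ⊆ range (D.polyTrace hι hC hv hmem hω hα k) := by
  induction h with
  | refl => exact Subset.rfl
  | step _ ih => exact ih.trans (by rw [range_polyTrace_succ]; exact subset_union_left)

/-- The pieces are in the range of the concatenation. [folklore] -/
theorem range_piece_subset {j k : ℕ} (h : j ≤ k) : range (D.piece hι hC hv hmem hω hα (idx m j)) ⊆ range (D.polyTrace hι hC hv hmem hω hα k) := by
  refine Subset.trans ?_ (D.range_polyTrace_mono hι hC hv hmem hω hα h)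
  cases j with
  | zero => exact Subset.rfl
  | succ j => rw [range_polyTrace_succ]; exact subset_union_right

/-- **Every piece of the cycle is on the polygon loop.** [folklore] -/
theorem range_piece_subset_range_polyLoop (i : Fin m) : range (D.piece hι hC hv hmem hω hα i) ⊆ range (D.polyLoop hι hC hv hmem hω hα) := by
  rw [range_polyLoop]
  have hi : idx m i.val = i := Fin.ext (by simp [Nat.mod_eq_of_lt i.2])
  rw [← hi]
  exact D.range_piece_subset hι hC hv hmem hω hα (by have := i.2; omega)

/-- **The punctures of the cycle are on the polygon loop.** [folklore] -/
theorem vtx_mem_range_polyLoop (i : Fin m) : vtx i ∈ range (D.polyLoop hι hC hv hmem hω hα) :=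
  D.range_piece_subset_range_polyLoop hι hC hv hmem hω hα i ⟨0, D.piece_zero hι hC hv hmem hω hα i⟩

/-- **The separatrix leaves of the cycle are on the polygon loop** (their link arcs are). [folklore] -/
theorem linkArc_mem_range_polyLoop (i : Fin m) (u : I) : D.linkArc hι hC hv hmem hω hα i u ∈ range (D.polyLoop hι hC hv hmem hω hα) := by
  refine D.range_piece_subset_range_polyLoop hι hC hv hmem hω hα i ⟨halfPt (halfPt' u), ?_⟩
  rw [piece, transFun_halfPt]
  rcases eq_or_lt_of_le u.2.1 with h0 | h0
  · have : u = 0 := Subtype.ext h0.symm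
    rw [this, ← D.outArc_one hι hC hv hmem hω hα i]
    -- `halfPt' 0 = 1/2`: the junction, read in the first piece
    rw [transFun_apply_of_le (show ((halfPt' (0 : I) : I) : ℝ) ≤ 1 / 2 by show (((0 : I) : ℝ) + 1) / 2 ≤ 1 / 2; norm_num)]
    congr 1
    apply Subtype.ext
    rw [coe_fstHalf (show ((halfPt' (0 : I) : I) : ℝ) ≤ 1 / 2 by show (((0 : I) : ℝ) + 1) / 2 ≤ 1 / 2; norm_num)]
    show 2 * ((((0 : I) : ℝ) + 1) / 2) = 1
    norm_num
  · exact transFun_halfPt' h0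

end Polygon

end StarData

end Literature.Topology.PlanarFoliations
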